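import Literature.Geometry.Lorentzian.HypersurfaceHessian
import HarnessLib

/-!
# The Hessian and Laplacian of a function restricted to an immersed submanifold of codimension two

Companion of `HypersurfaceHessian.lean` (codimension one). For a spacelike immersion
`f : (N, f^*g) → (M, g)` with `dim M = dim N + 2`, two mutually orthogonal unit normal fields
`ν₁, ν₂` along `f` of signs `ε₁, ε₂ ≠ 0` (smooth lifts to `TM`), second fundamental forms
`Kᵢ(v, w) = g(D_v νᵢ, df w)` and mean curvatures `Hᵢ = tr_{f^*g} Kᵢ`, and a `C²` function `φ` on
`M`:

* `PseudoRiemannianMetric.val_eq_inducedMetric_add_normal₂` — the tangent–normal decomposition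
  `g(A, B) = (f^*g)(a, b) + g(A, ν₁) g(B, ν₁)/ε₁ + g(A, ν₂) g(B, ν₂)/ε₂` at a point
  (`df(T_y N) ⊕ ℝν₁ ⊕ ℝν₂ = T_{f y} M`, a dimension count);
* `PseudoRiemannianMetric.hessian_comp_apply_localFrame₂`, `hessian_comp_apply₂` —
  `Hess_{f^*g}(φ ∘ f)(v, w) = Hess_g φ(df v, df w) − (dφ(ν₁)/ε₁) K₁(v, w) − (dφ(ν₂)/ε₂) K₂(v, w)`;
* `PseudoRiemannianMetric.dalembertian_comp_eq₂` —
  `Δ_{f^*g}(φ ∘ f) = tr_{f^*g}(Hess_g φ ∘ (df × df)) − (dφ(ν₁)/ε₁) H₁ − (dφ(ν₂)/ε₂) H₂`.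

This is O'Neill 1983, Ch. 4, Lemma 3, Cor. 2 (5), Lemma 4 and pp. 97–100 (`D̄_V W = D_V W + II(V, W)`,
`II` valued in the normal bundle, here spanned by the orthogonal frame `ν₁, ν₂`:
`II(v, w) = −ε₁ K₁(v, w) ν₁ − ε₂ K₂(v, w) ν₂`), applied to `V(Wφ)` exactly as in the
hypersurface file; the proofs are those of `HypersurfaceHessian.lean` verbatim, with the
two-normal decomposition replacing the one-normal one. Used for closed hypersurfaces `Σ` of the
round cylinder `N = S⁴ × ℝ ⊂ ℝ⁶` (codimension two in `ℝ⁶`, normals: the normal of `Σ` in `N` and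
the radial normal of `N`), where it gives `∫_Σ Δ_Σ(φ|_Σ) = 0` in ambient terms (Hamilton's
monotonicity formula in `N`).

Everything is proved; no definitions, no named facts.

## References

* B. O'Neill, *Semi-Riemannian geometry*, Academic Press 1983, Ch. 3, Def. 3.48–Lemma 3.49
  (Hessian), Ch. 4, Lemma 1, Cor. 2, Lemma 3, Lemma 4, pp. 97–100 (Gauss formula, shape tensor,
  `tan`/`nor`). [ONeill1983]
-/

noncomputable section

open Bundle Set Filter Function Manifold FiberBundle
open scoped Manifold ContDiff Topology

namespace Literature.Geometry.Lorentzian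

namespace PseudoRiemannianMetric

variable {E : Type*} [NormedAddCommGroup E] [NormedSpace ℝ E] {H : Type*} [TopologicalSpace H]
  {I : ModelWithCorners ℝ E H} {M : Type*} [TopologicalSpace M] [ChartedSpace H M]
  [IsManifold I ∞ M] [FiniteDimensional ℝ E]

/-! ### Tangent–normal decomposition at a point, codimension two -/

section Decomposition

variable {n : ℕ∞ω} (g : PseudoRiemannianMetric I n E (TangentSpace I : M → Type _))
  {E' : Type*} [NormedAddCommGroup E'] [NormedSpace ℝ E'] {H' : Type*} [TopologicalSpace H']
  {I' : ModelWithCorners ℝ E' H'} {N : Type*} [TopologicalSpace N] [ChartedSpace H' N]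
  [IsManifold I' ∞ N] [FiniteDimensional ℝ E'] {f : N → M}
  (hpb : PseudoRiemannianMetric.contMDiff_pullbackBilin I M I' N n)
  (hfi : g.IsSpacelikeImmersion I' f)

/-- **Tangent–normal decomposition of the metric at a point of an immersed submanifold of
codimension two.** Let `f : (N, f^*g) → (M, g)` be a spacelike immersion with `dim M = dim N + 2`
and `ν₁, ν₂` vectors at `f y` normal to `df(T_y N)`, mutually orthogonal, with
`g(νᵢ, νᵢ) = εᵢ ≠ 0`. If the tangential components of `A, B ∈ T_{f y} M` are `a, b ∈ T_y N`
(`g(A, df u) = (f^*g)(a, u)`, `g(B, df u) = (f^*g)(b, u)` for all `u`), then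
`g(A, B) = (f^*g)(a, b) + g(A, ν₁) g(B, ν₁)/ε₁ + g(A, ν₂) g(B, ν₂)/ε₂`: indeed
`A = df a + (g(A, ν₁)/ε₁) ν₁ + (g(A, ν₂)/ε₂) ν₂`, the difference being orthogonal to
`df(T_y N) ⊕ ℝν₁ ⊕ ℝν₂ = T_{f y} M` (dimension count) and `g` nondegenerate. O'Neill 1983, Ch. 4,
pp. 97–100 (`T_p M̄ = T_p M ⊕ T_p M^⊥`, `tan`, `nor`). [cite: ONeill1983, Ch. 4, pp. 97–100] -/
theorem val_eq_inducedMetric_add_normal₂ {y : N} {ν₁ ν₂ A B : TangentSpace I (f y)}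
    {a b : TangentSpace I' y} {ε₁ ε₂ : ℝ}
    (hν₁0 : ∀ u : TangentSpace I' y, g.val (f y) ν₁ (mfderiv I' I f y u) = 0)
    (hν₂0 : ∀ u : TangentSpace I' y, g.val (f y) ν₂ (mfderiv I' I f y u) = 0)
    (hν₁ε : g.val (f y) ν₁ ν₁ = ε₁) (hν₂ε : g.val (f y) ν₂ ν₂ = ε₂) (hε₁ : ε₁ ≠ 0) (hε₂ : ε₂ ≠ 0)
    (h₁₂ : g.val (f y) ν₁ ν₂ = 0)
    (hdim : Module.finrank ℝ E = Module.finrank ℝ E' + 2)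
    (hA : ∀ u : TangentSpace I' y, g.val (f y) A (mfderiv I' I f y u) =
      (g.inducedMetric f hpb hfi).val y a u)
    (hB : ∀ u : TangentSpace I' y, g.val (f y) B (mfderiv I' I f y u) =
      (g.inducedMetric f hpb hfi).val y b u) :
    g.val (f y) A B = (g.inducedMetric f hpb hfi).val y a b +
      g.val (f y) A ν₁ * g.val (f y) B ν₁ / ε₁ + g.val (f y) A ν₂ * g.val (f y) B ν₂ / ε₂ := by
  have hinj := hfi.injective_mfderiv y
  have h₂₁ : g.val (f y) ν₂ ν₁ = 0 := by rw [g.symm (f y) ν₂ ν₁]; exact h₁₂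
  -- `df(T_y N) ⊕ ℝ ν₁ ⊕ ℝ ν₂ = T_{f y} M`
  haveI : FiniteDimensional ℝ (TangentSpace I (f y)) := inferInstanceAs (FiniteDimensional ℝ E)
  set Φ : (E' × (ℝ × ℝ)) →ₗ[ℝ] TangentSpace I (f y) :=
    (mfderiv I' I f y).toLinearMap.comp (LinearMap.fst ℝ E' (ℝ × ℝ)) +
      ((LinearMap.fst ℝ ℝ ℝ).comp (LinearMap.snd ℝ E' (ℝ × ℝ))).smulRight ν₁ +
      ((LinearMap.snd ℝ ℝ ℝ).comp (LinearMap.snd ℝ E' (ℝ × ℝ))).smulRight ν₂ with hΦ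
  have hΦapply : ∀ (u : E') (r s : ℝ), Φ (u, (r, s)) = mfderiv I' I f y u + r • ν₁ + s • ν₂ :=
    fun u r s ↦ rfl
  have hΦinj : Function.Injective Φ := by
    refine (injective_iff_map_eq_zero _).2 fun q hq ↦ ?_
    obtain ⟨u, r, s⟩ := q
    rw [hΦapply] at hq
    have h1 : r * ε₁ = 0 := by
      have := congrArg (fun w ↦ g.val (f y) ν₁ w) hq
      simpa [map_add, map_smul, hν₁0 u, hν₁ε, h₁₂] using this
    have h2 : s * ε₂ = 0 := by
      have := congrArg (fun w ↦ g.val (f y) ν₂ w) hq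
      simpa [map_add, map_smul, hν₂0 u, hν₂ε, h₂₁] using this
    have hr : r = 0 := (mul_eq_zero.1 h1).resolve_right hε₁
    have hs : s = 0 := (mul_eq_zero.1 h2).resolve_right hε₂
    rw [hr, hs, zero_smul, zero_smul, add_zero, add_zero] at hq
    have hu : u = 0 := (injective_iff_map_eq_zero _).1 hinj u hq
    simp [hu, hr, hs]
  have hrank : Module.finrank ℝ (E' × (ℝ × ℝ)) = Module.finrank ℝ (TangentSpace I (f y)) := by
    show Module.finrank ℝ (E' × (ℝ × ℝ)) = Module.finrank ℝ E
    rw [Module.finrank_prod, Module.finrank_prod, Module.finrank_self, hdim]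
  have hΦsurj : Function.Surjective Φ :=
    (LinearMap.injective_iff_surjective_of_finrank_eq_finrank hrank).1 hΦinj
  -- the decomposition of `A`
  have hdec : A = mfderiv I' I f y a + (g.val (f y) A ν₁ / ε₁) • ν₁ + (g.val (f y) A ν₂ / ε₂) • ν₂ := by
    have horth : ∀ w : TangentSpace I (f y),
        g.val (f y) (A - mfderiv I' I f y a - (g.val (f y) A ν₁ / ε₁) • ν₁ -
          (g.val (f y) A ν₂ / ε₂) • ν₂) w = 0 := by
      intro w
      obtain ⟨⟨u, r, s⟩, rfl⟩ := hΦsurj w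
      rw [hΦapply, map_add, map_add, map_smul, map_smul]
      have h1 : g.val (f y) (A - mfderiv I' I f y a - (g.val (f y) A ν₁ / ε₁) • ν₁ -
          (g.val (f y) A ν₂ / ε₂) • ν₂) (mfderiv I' I f y u) = 0 := by
        simp only [map_sub, map_smul, _root_.sub_apply, _root_.smul_apply, hA u, hν₁0 u, hν₂0 u,
          smul_eq_mul, mul_zero, sub_zero]
        exact sub_self _
      have h2 : g.val (f y) (A - mfderiv I' I f y a - (g.val (f y) A ν₁ / ε₁) • ν₁ -
          (g.val (f y) A ν₂ / ε₂) • ν₂) ν₁ = 0 := by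
        simp only [map_sub, map_smul, _root_.sub_apply, _root_.smul_apply, hν₁ε, h₂₁, smul_eq_mul]
        rw [g.symm (f y) (mfderiv I' I f y a) ν₁, hν₁0 a]
        field_simp
        ring
      have h3 : g.val (f y) (A - mfderiv I' I f y a - (g.val (f y) A ν₁ / ε₁) • ν₁ -
          (g.val (f y) A ν₂ / ε₂) • ν₂) ν₂ = 0 := by
        simp only [map_sub, map_smul, _root_.sub_apply, _root_.smul_apply, hν₂ε, h₁₂, smul_eq_mul]
        rw [g.symm (f y) (mfderiv I' I f y a) ν₂, hν₂0 a]
        field_simp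
        ring
      rw [h1, h2, h3, smul_zero, smul_zero, add_zero, add_zero]
    have h0 := g.nondegenerate (f y) _ horth
    rw [sub_sub, sub_sub, sub_eq_zero] at h0
    rw [← add_assoc] at h0
    exact h0
  -- pair with `B`
  conv_lhs => rw [hdec]
  rw [map_add, map_add, map_smul, map_smul, _root_.add_apply, _root_.add_apply, _root_.smul_apply,
    _root_.smul_apply, g.symm (f y) (mfderiv I' I f y a) B, hB a,
    (g.inducedMetric f hpb hfi).symm y b a, g.symm (f y) ν₁ B, g.symm (f y) ν₂ B, smul_eq_mul,
    smul_eq_mul]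
  ring

end Decomposition

/-! ### The restricted Hessian on a coordinate pair, codimension two -/

section Restricted

variable [CompleteSpace E] [I.Boundaryless]
  (g : PseudoRiemannianMetric I ∞ E (TangentSpace I : M → Type _)) [g.HasLeviCivita]
  {E' : Type*} [NormedAddCommGroup E'] [NormedSpace ℝ E'] {H' : Type*} [TopologicalSpace H']
  {I' : ModelWithCorners ℝ E' H'} {N : Type*} [TopologicalSpace N] [ChartedSpace H' N]
  [IsManifold I' ∞ N] [FiniteDimensional ℝ E'] [CompleteSpace E'] [I'.Boundaryless] {f : N → M}
  (hpb : PseudoRiemannianMetric.contMDiff_pullbackBilin I M I' N ∞)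
  (hfi : g.IsSpacelikeImmersion I' f) {ν₁ ν₂ : NormalField I f} {ε₁ ε₂ : ℝ}
  {ι : Type*} [Fintype ι] [DecidableEq ι] (b' : Module.Basis ι ℝ E') {y₀ : N}

set_option maxHeartbeats 1600000 in
-- the verbatim two-normal copy of `hessian_comp_apply_localFrame` needs the same heartbeat budget
/-- **The Hessian of a restricted function on a coordinate pair, codimension two** (O'Neill 1983,
Ch. 4, Lemma 3, Cor. 2 (5), Lemma 4). For a spacelike immersion `f : (N, f^*g) → (M, g)` with
`dim M = dim N + 2`, mutually orthogonal unit normal fields `ν₁, ν₂` of signs `ε₁, ε₂ ≠ 0` (smooth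
lifts), `φ ∈ C²(M)`, a point `y₀` and the coordinate frame `∂ₐ` of the chart of `N` at `y₀`:
`Hess_{f^*g}(φ ∘ f)(∂ₐ, ∂_c)(y₀) = Hess_g φ(df ∂ₐ, df ∂_c)(f y₀) − (dφ(ν₁)/ε₁) K₁(∂ₐ, ∂_c)(y₀)
− (dφ(ν₂)/ε₂) K₂(∂ₐ, ∂_c)(y₀)`. Proof: that of `hessian_comp_apply_localFrame`
(`Hess(φ∘f)(∂ₐ,∂_c) = ∂ₐ(∂_c(φ∘f)) − d(φ∘f)(∇_{∂ₐ}∂_c)`, `∂_c(φ∘f) = g(grad φ ∘ f, df ∂_c)`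
differentiated along the `a`-th coordinate line by metric compatibility), the term
`g(grad φ, D̄ₐ(df ∂_c))` being split by the two-normal tangent–normal decomposition
(`val_eq_inducedMetric_add_normal₂`) into `d(φ∘f)(∇_{∂ₐ}∂_c)` (Gauss formula, tangential part)
and `dφ(νᵢ) · (−Kᵢ(∂ₐ, ∂_c))/εᵢ` (`val_covariantDerivAlong_mfderiv_localFrame_normal₀`, twice).
[cite: ONeill1983, Ch. 4, Lemma 3 and Lemma 4] -/
theorem hessian_comp_apply_localFrame₂
    (hν₁ : ContMDiff I' I.tangent ∞ (fun x ↦ (TotalSpace.mk' E (f x) (ν₁ x) : TangentBundle I M)))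
    (hν₂ : ContMDiff I' I.tangent ∞ (fun x ↦ (TotalSpace.mk' E (f x) (ν₂ x) : TangentBundle I M)))
    (hun₁ : g.IsUnitNormal I' f ν₁ ε₁) (hun₂ : g.IsUnitNormal I' f ν₂ ε₂) (hε₁ : ε₁ ≠ 0)
    (hε₂ : ε₂ ≠ 0) (h₁₂ : ∀ y, g.val (f y) (ν₁ y) (ν₂ y) = 0)
    (hdim : Module.finrank ℝ E = Module.finrank ℝ E' + 2)
    {φ : M → ℝ} (hφ : CMDiff 2 φ) (a c : ι) :
    haveI := (g.inducedMetric f hpb hfi).hasLeviCivita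
    (g.inducedMetric f hpb hfi).hessian (fun y ↦ φ (f y)) y₀
        ((trivializationAt E' (TangentSpace I') y₀).localFrame b' a y₀)
        ((trivializationAt E' (TangentSpace I') y₀).localFrame b' c y₀) =
      g.hessian φ (f y₀)
          (mfderiv I' I f y₀ ((trivializationAt E' (TangentSpace I') y₀).localFrame b' a y₀))
          (mfderiv I' I f y₀ ((trivializationAt E' (TangentSpace I') y₀).localFrame b' c y₀)) -
        mvfderiv I φ (f y₀) (ν₁ y₀) / ε₁ *
          g.secondFundamentalForm I' f ν₁ y₀
            ((trivializationAt E' (TangentSpace I') y₀).localFrame b' a y₀)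
            ((trivializationAt E' (TangentSpace I') y₀).localFrame b' c y₀) -
        mvfderiv I φ (f y₀) (ν₂ y₀) / ε₂ *
          g.secondFundamentalForm I' f ν₂ y₀
            ((trivializationAt E' (TangentSpace I') y₀).localFrame b' a y₀)
            ((trivializationAt E' (TangentSpace I') y₀).localFrame b' c y₀) := by
  haveI := (g.inducedMetric f hpb hfi).hasLeviCivita
  set gN := g.inducedMetric f hpb hfi with hgN
  set e' := trivializationAt E' (TangentSpace I' : N → Type _) y₀ with he'
  set Gφ : Π x : M, TangentSpace I x := fun x ↦ g.sharp x (mvfderiv I φ x).toLinearMap with hGφ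
  -- regularity
  have hf : ContMDiff I' I ∞ f := PseudoRiemannianMetric.IsSpacelikeImmersion.contMDiff_self hfi
  have hf2 : ContMDiff I' I 2 f := hf.of_le (by exact WithTop.coe_le_coe.2 le_top)
  have hfd : ∀ z, MDifferentiableAt I' I f z := hf2.mdifferentiable two_ne_zero
  have hφd : ∀ x, MDifferentiableAt I 𝓘(ℝ, ℝ) φ x := hφ.mdifferentiable two_ne_zero
  have hcompatM := (PseudoRiemannianMetric.isLeviCivita_leviCivita_holds (g := g)).2
  have hI'1 : IsManifold I' (1 + 1) N := inferInstanceAs (IsManifold I' 2 N)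
  have hVB1 : ContMDiffVectorBundle 1 E' (TangentSpace I' : N → Type _) I' :=
    TangentBundle.contMDiffVectorBundle
  have hy₀ : y₀ ∈ (chartAt H' y₀).source := mem_chart_source H' y₀
  have hy₀e : y₀ ∈ e'.baseSet := FiberBundle.mem_baseSet_trivializationAt' y₀
  have hz : extChartAt I' y₀ y₀ ∈ (extChartAt I' y₀).target := mem_extChartAt_target y₀
  -- the `a`-th coordinate line `ℓ` through `y₀` and its base point `Q = y₀`
  set ℓ : ℝ → E' := fun t ↦ extChartAt I' y₀ y₀ + t • b' a with hℓdef
  have hℓ0 : ℓ 0 = extChartAt I' y₀ y₀ := by simp [hℓdef]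
  have hℓ0t : ℓ 0 ∈ (extChartAt I' y₀).target := by rw [hℓ0]; exact hz
  have hℓaff : ∀ t, ℓ t = ℓ 0 + t • b' a := fun t ↦ by simp [hℓdef]
  have hℓ : HasDerivAt ℓ (b' a) 0 := by
    simpa [hℓdef] using ((hasDerivAt_id (0 : ℝ)).smul_const (b' a)).const_add (extChartAt I' y₀ y₀)
  have hQ : (extChartAt I' y₀).symm (ℓ 0) = y₀ := by rw [hℓ0]; exact extChartAt_to_inv y₀
  set γN : ℝ → N := fun t ↦ (extChartAt I' y₀).symm (ℓ t) with hγN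
  have hγN0 : γN 0 = y₀ := hQ
  have hγNs : ContMDiffAt 𝓘(ℝ, ℝ) I' ∞ γN 0 := by
    have := contMDiffAt_chartLine (I' := I') hz (b' a)
    simpa [hγN, hℓdef] using this
  have hγNd : MDifferentiableAt 𝓘(ℝ, ℝ) I' γN 0 := hγNs.mdifferentiableAt (by simp)
  have hvelN : velocity I' γN 0 = e'.localFrame b' a y₀ := by
    have h1 := velocity_symm_comp₀ (I' := I') b' hℓ0t hℓ
    rw [hQ, sum_coord_basis_smul] at h1
    exact h1
  -- frame fields
  have hframe : ∀ d, MDiffAt (T% (e'.localFrame b' d)) y₀ := fun d ↦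
    (contMDiffAt_localFrame_of_mem 1 e' b' d hy₀e).mdifferentiableAt one_ne_zero
  -- (1) `Hess(φ∘f)(∂ₐ, ∂_c)(y₀) = ∂ₐ(∂_c(φ∘f))(y₀) − d(φ∘f)(∇_{∂ₐ}∂_c)(y₀)`
  have hφf2 : CMDiffAt 2 (fun y ↦ φ (f y)) y₀ := (hφ (f y₀)).comp y₀ (hf2 y₀)
  have hhessN := hessian_apply_holds (g := gN) (x := y₀) (f := fun y ↦ φ (f y)) hφf2
    (hframe a) (hframe c)
  rw [hhessN, hessianAux]
  -- (2) `∂_c(φ∘f) = g(grad φ ∘ f, df ∂_c)` pointwise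
  have hchain : ∀ y (v : TangentSpace I' y), mvfderiv I' (fun y ↦ φ (f y)) y v =
      mvfderiv I φ (f y) (mfderiv I' I f y v) := by
    intro y v
    simp only [mvfderiv, ContinuousLinearMap.comp_apply]
    rw [show (fun y ↦ φ (f y)) = φ ∘ f from rfl, mfderiv_comp y (hφd (f y)) (hfd y)]
    rfl
  have hfunc : (fun y ↦ mvfderiv I' (fun y ↦ φ (f y)) y (e'.localFrame b' c y)) =
      fun y ↦ g.val (f y) (Gφ (f y)) (mfderiv I' I f y (e'.localFrame b' c y)) := by
    funext y
    rw [hchain, hGφ, val_sharp_apply]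
    rfl
  rw [hfunc]
  -- (3) derivative along the coordinate line
  set u : ℝ → ℝ := fun t ↦ g.val (f (γN t)) (Gφ (f (γN t)))
    (mfderiv I' I f (γN t) (e'.localFrame b' c (γN t))) with hu
  have hGlift : MDifferentiableAt 𝓘(ℝ, ℝ) I.tangent
      (fun t ↦ (TotalSpace.mk' E (f (γN t)) (Gφ (f (γN t))) : TangentBundle I M)) 0 := by
    have h1 : MDiffAt (T% Gφ) (f (γN 0)) := g.mdifferentiableAt_sharp_mvfderiv (hφ (f (γN 0)))
    exact h1.comp 0 ((hfd (γN 0)).comp 0 hγNd)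
  have hVlift : MDifferentiableAt 𝓘(ℝ, ℝ) I.tangent
      (fun t ↦ (TotalSpace.mk' E (f (γN t)) (mfderiv I' I f (γN t) (e'.localFrame b' c (γN t))) :
        TangentBundle I M)) 0 := by
    have h1 := mdifferentiableAt_lift_mfderiv (I := I) (I' := I') hf2
      (W := e'.localFrame b' c) (z₀ := γN 0) (by rw [hγN0]; exact hframe c)
    exact h1.comp 0 hγNd
  have hud := g.hasDerivAt_val_apply_along hcompatM (γ := fun t ↦ f (γN t))
    (V := fun t ↦ Gφ (f (γN t)))
    (W := fun t ↦ mfderiv I' I f (γN t) (e'.localFrame b' c (γN t))) hGlift hVlift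
  -- the same derivative as an `mvfderiv` along the line
  have hFc : MDifferentiableAt I' 𝓘(ℝ, ℝ) (fun y ↦ g.val (f y) (Gφ (f y))
      (mfderiv I' I f y (e'.localFrame b' c y))) y₀ := by
    have h1 : MDifferentiableAt I' 𝓘(ℝ, ℝ)
        (fun y ↦ mvfderiv I' (fun y ↦ φ (f y)) y (e'.localFrame b' c y)) y₀ :=
      (contMDiffAt_mvfderiv_localFrame b' hy₀ hφf2 c).mdifferentiableAt one_ne_zero
    rw [hfunc] at h1
    exact h1
  have hud' := hasDerivAt_comp_curve (γ := γN) (t := 0) (f := fun y ↦ g.val (f y) (Gφ (f y))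
      (mfderiv I' I f y (e'.localFrame b' c y))) (by rw [hγN0]; exact hFc) hγNd
  rw [hvelN] at hud'
  have hderiv_eq := hud.unique hud'
  -- (4) the first term: `Hess φ(df ∂ₐ, df ∂_c)`
  have hT1 : g.val (f (γN 0)) (covariantDerivAlong g.leviCivita (fun t ↦ f (γN t))
      (fun t ↦ Gφ (f (γN t))) 0) (mfderiv I' I f (γN 0) (e'.localFrame b' c (γN 0))) =
      g.hessian φ (f y₀) (mfderiv I' I f y₀ (e'.localFrame b' a y₀))
        (mfderiv I' I f y₀ (e'.localFrame b' c y₀)) := by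
    have hcomp := covariantDerivAlong_comp_holds g.leviCivita (γ := fun t ↦ f (γN t))
      (Y := Gφ) (t₀ := 0) ((hfd (γN 0)).comp 0 hγNd)
      (g.mdifferentiableAt_sharp_mvfderiv (hφ (f (γN 0))))
    have hvelM : velocity I (fun t ↦ f (γN t)) 0 = mfderiv I' I f (γN 0) (velocity I' γN 0) :=
      velocity_comp (hfd (γN 0)) hγNd
    rw [hcomp, hvelM, hvelN]
    have key : ∀ z, y₀ = z → g.val (f z) (g.leviCivita Gφ (f z) (mfderiv I' I f z
        (e'.localFrame b' a y₀))) (mfderiv I' I f z (e'.localFrame b' c z)) =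
        g.hessian φ (f y₀) (mfderiv I' I f y₀ (e'.localFrame b' a y₀))
          (mfderiv I' I f y₀ (e'.localFrame b' c y₀)) := by
      rintro z rfl
      exact g.val_leviCivita_grad_eq_hessian (hφ (f y₀)) _ _
    exact key _ hγN0.symm
  -- (5) the second term: tangent–normal decomposition with the two normals
  have hnormal₁ := val_covariantDerivAlong_mfderiv_localFrame_normal₀ g b' hf2 hν₁
    hun₁.isNormalTo hℓ0t hℓaff c
  have hnormal₂ := val_covariantDerivAlong_mfderiv_localFrame_normal₀ g b' hf2 hν₂
    hun₂.isNormalTo hℓ0t hℓaff c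
  have htang := fun w ↦ val_covariantDerivAlong_mfderiv_localFrame_symm_comp₀ g hpb hfi b' hℓ0t
    hℓaff c w
  -- tangential part of `grad φ`
  have hA : ∀ w : TangentSpace I' ((extChartAt I' y₀).symm (ℓ 0)),
      g.val (f ((extChartAt I' y₀).symm (ℓ 0))) (Gφ (f ((extChartAt I' y₀).symm (ℓ 0))))
        (mfderiv I' I f ((extChartAt I' y₀).symm (ℓ 0)) w) =
      (g.inducedMetric f hpb hfi).val ((extChartAt I' y₀).symm (ℓ 0))
        ((g.inducedMetric f hpb hfi).sharp ((extChartAt I' y₀).symm (ℓ 0))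
          (mvfderiv I' (fun y ↦ φ (f y)) ((extChartAt I' y₀).symm (ℓ 0))).toLinearMap) w := by
    intro w
    rw [val_sharp_apply, val_sharp_apply]
    exact (hchain _ w).symm
  have hdecomp := val_eq_inducedMetric_add_normal₂ g hpb hfi
    (y := (extChartAt I' y₀).symm (ℓ 0)) (ν₁ := ν₁ ((extChartAt I' y₀).symm (ℓ 0)))
    (ν₂ := ν₂ ((extChartAt I' y₀).symm (ℓ 0)))
    (A := Gφ (f ((extChartAt I' y₀).symm (ℓ 0))))
    (B := covariantDerivAlong g.leviCivita (fun t : ℝ ↦ f ((extChartAt I' y₀).symm (ℓ t)))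
      (fun t ↦ mfderiv I' I f ((extChartAt I' y₀).symm (ℓ t))
        (e'.localFrame b' c ((extChartAt I' y₀).symm (ℓ t)))) 0)
    (ε₁ := ε₁) (ε₂ := ε₂) (fun w ↦ hun₁.isNormalTo _ w) (fun w ↦ hun₂.isNormalTo _ w)
    (hun₁.val_self _) (hun₂.val_self _) hε₁ hε₂ (h₁₂ _) hdim hA htang
  -- the pieces at the base point `Q = φ⁻¹(ℓ 0)`, in syntactically uniform form
  have hnormal₁' : g.val (f ((extChartAt I' y₀).symm (ℓ 0)))
      (covariantDerivAlong g.leviCivita (fun t : ℝ ↦ f ((extChartAt I' y₀).symm (ℓ t)))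
        (fun t ↦ mfderiv I' I f ((extChartAt I' y₀).symm (ℓ t))
          (e'.localFrame b' c ((extChartAt I' y₀).symm (ℓ t)))) 0)
      (ν₁ ((extChartAt I' y₀).symm (ℓ 0))) =
      -(g.secondFundamentalForm I' f ν₁ ((extChartAt I' y₀).symm (ℓ 0))
        (e'.localFrame b' a ((extChartAt I' y₀).symm (ℓ 0)))
        (e'.localFrame b' c ((extChartAt I' y₀).symm (ℓ 0)))) := hnormal₁
  have hnormal₂' : g.val (f ((extChartAt I' y₀).symm (ℓ 0)))
      (covariantDerivAlong g.leviCivita (fun t : ℝ ↦ f ((extChartAt I' y₀).symm (ℓ t)))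
        (fun t ↦ mfderiv I' I f ((extChartAt I' y₀).symm (ℓ t))
          (e'.localFrame b' c ((extChartAt I' y₀).symm (ℓ t)))) 0)
      (ν₂ ((extChartAt I' y₀).symm (ℓ 0))) =
      -(g.secondFundamentalForm I' f ν₂ ((extChartAt I' y₀).symm (ℓ 0))
        (e'.localFrame b' a ((extChartAt I' y₀).symm (ℓ 0)))
        (e'.localFrame b' c ((extChartAt I' y₀).symm (ℓ 0)))) := hnormal₂
  have hGν₁ : g.val (f ((extChartAt I' y₀).symm (ℓ 0))) (Gφ (f ((extChartAt I' y₀).symm (ℓ 0))))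
      (ν₁ ((extChartAt I' y₀).symm (ℓ 0))) = mvfderiv I φ (f ((extChartAt I' y₀).symm (ℓ 0)))
        (ν₁ ((extChartAt I' y₀).symm (ℓ 0))) := by
    rw [hGφ, val_sharp_apply]; rfl
  have hGν₂ : g.val (f ((extChartAt I' y₀).symm (ℓ 0))) (Gφ (f ((extChartAt I' y₀).symm (ℓ 0))))
      (ν₂ ((extChartAt I' y₀).symm (ℓ 0))) = mvfderiv I φ (f ((extChartAt I' y₀).symm (ℓ 0)))
        (ν₂ ((extChartAt I' y₀).symm (ℓ 0))) := by
    rw [hGφ, val_sharp_apply]; rfl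
  have hNcov' : covariantDerivAlong (g.inducedMetric f hpb hfi).leviCivita
      (fun t : ℝ ↦ (extChartAt I' y₀).symm (ℓ t))
      (fun t ↦ (trivializationAt E' (TangentSpace I') y₀).localFrame b' c
        ((extChartAt I' y₀).symm (ℓ t))) 0 =
      gN.leviCivita (e'.localFrame b' c) ((extChartAt I' y₀).symm (ℓ 0))
        (e'.localFrame b' a ((extChartAt I' y₀).symm (ℓ 0))) := by
    rw [covariantDerivAlong_localFrame_symm_comp₀ b' gN.leviCivita hℓ0t hℓ c, sum_coord_basis_smul]
  have e3 : ∀ z, (extChartAt I' y₀).symm (ℓ 0) = z →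
      g.val (f ((extChartAt I' y₀).symm (ℓ 0))) (Gφ (f ((extChartAt I' y₀).symm (ℓ 0))))
        (covariantDerivAlong g.leviCivita (fun t : ℝ ↦ f ((extChartAt I' y₀).symm (ℓ t)))
          (fun t ↦ mfderiv I' I f ((extChartAt I' y₀).symm (ℓ t))
            (e'.localFrame b' c ((extChartAt I' y₀).symm (ℓ t)))) 0) =
      mvfderiv I' (fun y ↦ φ (f y)) z (gN.leviCivita (e'.localFrame b' c) z
          (e'.localFrame b' a z)) +
        mvfderiv I φ (f z) (ν₁ z) *
          (-(g.secondFundamentalForm I' f ν₁ z (e'.localFrame b' a z) (e'.localFrame b' c z))) /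
            ε₁ +
        mvfderiv I φ (f z) (ν₂ z) *
          (-(g.secondFundamentalForm I' f ν₂ z (e'.localFrame b' a z) (e'.localFrame b' c z))) /
            ε₂ := by
    rintro z rfl
    rw [hdecomp, hnormal₁', hnormal₂', hGν₁, hGν₂, hNcov', val_sharp_apply]
    rfl
  have hT2' : g.val (f (γN 0)) (Gφ (f (γN 0))) (covariantDerivAlong g.leviCivita
      (fun t ↦ f (γN t)) (fun t ↦ mfderiv I' I f (γN t) (e'.localFrame b' c (γN t))) 0) =
      mvfderiv I' (fun y ↦ φ (f y)) y₀ (gN.leviCivita (e'.localFrame b' c) y₀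
          (e'.localFrame b' a y₀)) +
        mvfderiv I φ (f y₀) (ν₁ y₀) *
          (-(g.secondFundamentalForm I' f ν₁ y₀ (e'.localFrame b' a y₀) (e'.localFrame b' c y₀))) /
            ε₁ +
        mvfderiv I φ (f y₀) (ν₂ y₀) *
          (-(g.secondFundamentalForm I' f ν₂ y₀ (e'.localFrame b' a y₀) (e'.localFrame b' c y₀))) /
            ε₂ := e3 y₀ hQ
  -- the left-hand side of the goal, through `hderiv_eq`
  have key : ∀ z, γN 0 = z →
      mvfderiv I' (fun y ↦ g.val (f y) (Gφ (f y)) (mfderiv I' I f y (e'.localFrame b' c y))) z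
        (e'.localFrame b' a y₀) =
      g.val (f (γN 0)) (covariantDerivAlong g.leviCivita (fun t ↦ f (γN t))
        (fun t ↦ Gφ (f (γN t))) 0) (mfderiv I' I f (γN 0) (e'.localFrame b' c (γN 0))) +
      g.val (f (γN 0)) (Gφ (f (γN 0))) (covariantDerivAlong g.leviCivita (fun t ↦ f (γN t))
        (fun t ↦ mfderiv I' I f (γN t) (e'.localFrame b' c (γN t))) 0) := by
    rintro z rfl
    exact hderiv_eq.symm
  rw [key y₀ hγN0, hT1, hT2']
  field_simp
  ring


/-- **The Hessian of a restricted function, codimension two**: for all `v, w ∈ T_{y₀} N`,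
`Hess_{f^*g}(φ ∘ f)(v, w) = Hess_g φ(df v, df w) − (dφ(ν₁)/ε₁) K₁(v, w) − (dφ(ν₂)/ε₂) K₂(v, w)`
(both sides are bilinear and agree on the coordinate frame at `y₀`,
`hessian_comp_apply_localFrame₂`). O'Neill 1983, Ch. 4, Lemma 3 and Lemma 4.
[cite: ONeill1983, Ch. 4, Lemma 3 and Lemma 4] -/
theorem hessian_comp_apply₂
    (hν₁ : ContMDiff I' I.tangent ∞ (fun x ↦ (TotalSpace.mk' E (f x) (ν₁ x) : TangentBundle I M)))
    (hν₂ : ContMDiff I' I.tangent ∞ (fun x ↦ (TotalSpace.mk' E (f x) (ν₂ x) : TangentBundle I M)))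
    (hun₁ : g.IsUnitNormal I' f ν₁ ε₁) (hun₂ : g.IsUnitNormal I' f ν₂ ε₂) (hε₁ : ε₁ ≠ 0)
    (hε₂ : ε₂ ≠ 0) (h₁₂ : ∀ y, g.val (f y) (ν₁ y) (ν₂ y) = 0)
    (hdim : Module.finrank ℝ E = Module.finrank ℝ E' + 2)
    {φ : M → ℝ} (hφ : CMDiff 2 φ) (y₀ : N) (v w : TangentSpace I' y₀) :
    haveI := (g.inducedMetric f hpb hfi).hasLeviCivita
    (g.inducedMetric f hpb hfi).hessian (fun y ↦ φ (f y)) y₀ v w =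
      g.hessian φ (f y₀) (mfderiv I' I f y₀ v) (mfderiv I' I f y₀ w) -
        mvfderiv I φ (f y₀) (ν₁ y₀) / ε₁ * g.secondFundamentalForm I' f ν₁ y₀ v w -
        mvfderiv I φ (f y₀) (ν₂ y₀) / ε₂ * g.secondFundamentalForm I' f ν₂ y₀ v w := by
  classical
  haveI := (g.inducedMetric f hpb hfi).hasLeviCivita
  set bE := Module.finBasis ℝ E' with hbE
  -- the two bilinear forms
  set B₁ : LinearMap.BilinForm ℝ (TangentSpace I' y₀) :=
    (g.inducedMetric f hpb hfi).hessian (fun y ↦ φ (f y)) y₀ with hB₁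
  set B₂ : LinearMap.BilinForm ℝ (TangentSpace I' y₀) :=
    (g.hessian φ (f y₀)).comp (mfderiv I' I f y₀).toLinearMap (mfderiv I' I f y₀).toLinearMap -
      (mvfderiv I φ (f y₀) (ν₁ y₀) / ε₁) • g.secondFundamentalForm I' f ν₁ y₀ -
      (mvfderiv I φ (f y₀) (ν₂ y₀) / ε₂) • g.secondFundamentalForm I' f ν₂ y₀ with hB₂
  have hb : ∀ i, (trivializationAt E' (TangentSpace I') y₀).localFrame bE i y₀ = bE i :=
    fun i ↦ localFrame_trivializationAt_self bE y₀ i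
  have heq : B₁ = B₂ := by
    refine LinearMap.BilinForm.ext_basis (b := (bE : Module.Basis _ ℝ (TangentSpace I' y₀)))
      fun i j ↦ ?_
    have h1 := g.hessian_comp_apply_localFrame₂ hpb hfi bE (y₀ := y₀) hν₁ hν₂ hun₁ hun₂ hε₁ hε₂
      h₁₂ hdim hφ i j
    rw [hb i, hb j] at h1
    simp only [hB₁, hB₂, LinearMap.BilinForm.sub_apply, LinearMap.smul_apply,
      LinearMap.BilinForm.comp_apply, ContinuousLinearMap.coe_coe, smul_eq_mul]
    exact h1
  have h := congrArg (fun B : LinearMap.BilinForm ℝ (TangentSpace I' y₀) ↦ B v w) heq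
  simp only [hB₁, hB₂, LinearMap.BilinForm.sub_apply, LinearMap.smul_apply,
    LinearMap.BilinForm.comp_apply, ContinuousLinearMap.coe_coe, smul_eq_mul] at h
  exact h

/-- **The Laplacian of a restricted function, codimension two**:
`Δ_{f^*g}(φ ∘ f)(y₀) = tr_{f^*g} (Hess_g φ ∘ (df × df))(y₀) − (dφ(ν₁)/ε₁) H₁(y₀) − (dφ(ν₂)/ε₂) H₂(y₀)`,
the trace of `hessian_comp_apply₂` (`Hᵢ = tr_{f^*g} Kᵢ` the mean curvatures with respect to
the two normals, i.e. `dφ` of the mean curvature vector `−ε₁ H₁ ν₁ − ε₂ H₂ ν₂`). O'Neill 1983,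
Ch. 4, Lemma 3 and Lemma 4 with Ch. 3, Def. 3.50. [cite: ONeill1983, Ch. 4, Lemma 3 and Lemma 4] -/
theorem dalembertian_comp_eq₂
    (hν₁ : ContMDiff I' I.tangent ∞ (fun x ↦ (TotalSpace.mk' E (f x) (ν₁ x) : TangentBundle I M)))
    (hν₂ : ContMDiff I' I.tangent ∞ (fun x ↦ (TotalSpace.mk' E (f x) (ν₂ x) : TangentBundle I M)))
    (hun₁ : g.IsUnitNormal I' f ν₁ ε₁) (hun₂ : g.IsUnitNormal I' f ν₂ ε₂) (hε₁ : ε₁ ≠ 0)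
    (hε₂ : ε₂ ≠ 0) (h₁₂ : ∀ y, g.val (f y) (ν₁ y) (ν₂ y) = 0)
    (hdim : Module.finrank ℝ E = Module.finrank ℝ E' + 2)
    {φ : M → ℝ} (hφ : CMDiff 2 φ) (y₀ : N) :
    haveI := (g.inducedMetric f hpb hfi).hasLeviCivita
    (g.inducedMetric f hpb hfi).dalembertian (fun y ↦ φ (f y)) y₀ =
      (g.inducedMetric f hpb hfi).trace y₀
          ((g.hessian φ (f y₀)).comp (mfderiv I' I f y₀).toLinearMap
            (mfderiv I' I f y₀).toLinearMap) -
        mvfderiv I φ (f y₀) (ν₁ y₀) / ε₁ * g.meanCurvature f hpb hfi ν₁ y₀ -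
        mvfderiv I φ (f y₀) (ν₂ y₀) / ε₂ * g.meanCurvature f hpb hfi ν₂ y₀ := by
  haveI := (g.inducedMetric f hpb hfi).hasLeviCivita
  have heq : (g.inducedMetric f hpb hfi).hessian (fun y ↦ φ (f y)) y₀ =
      (g.hessian φ (f y₀)).comp (mfderiv I' I f y₀).toLinearMap (mfderiv I' I f y₀).toLinearMap -
        (mvfderiv I φ (f y₀) (ν₁ y₀) / ε₁) • g.secondFundamentalForm I' f ν₁ y₀ -
        (mvfderiv I φ (f y₀) (ν₂ y₀) / ε₂) • g.secondFundamentalForm I' f ν₂ y₀ := by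
    refine LinearMap.ext fun v ↦ LinearMap.ext fun w ↦ ?_
    rw [g.hessian_comp_apply₂ hpb hfi hν₁ hν₂ hun₁ hun₂ hε₁ hε₂ h₁₂ hdim hφ y₀ v w]
    simp only [LinearMap.BilinForm.sub_apply, LinearMap.smul_apply,
      LinearMap.BilinForm.comp_apply, ContinuousLinearMap.coe_coe, smul_eq_mul]
  rw [dalembertian, heq, trace_sub, trace_sub, trace_smul, trace_smul, meanCurvature, meanCurvature]

end Restricted


end PseudoRiemannianMetric

end Literature.Geometry.Lorentzian

end
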